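import Literature.AlgebraicGeometry.Motives.FaltingsECEndomorphismsProofs
import Literature.AlgebraicGeometry.Motives.FaltingsECSubspaces
import Literature.AlgebraicGeometry.Motives.FaltingsECTateLemma1Proofs
import Literature.NumberTheory.EllipticCurves.IsogenyCompProofs
import Literature.NumberTheory.EllipticCurves.IsogenyGeomEndRingProofs
import HarnessLib

/-!
# Faltings' Satz 4 and Korollar 1 for elliptic curves: the implications among the named facts

D-0014 keeps `Literature/` sorry-free by stating cited results as named facts `def X : Prop`.
This sibling proof file of `Literature.AlgebraicGeometry.Motives.FaltingsEC` concerns the named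
fact `Literature.Hodge.mem_span_range_tateModule_map_of_equivariant W W' ℓ`: for elliptic curves `E, E'`
over a number field `K` and a prime `ℓ`, every `Γ_K`-equivariant `ℤ_ℓ`-linear map
`T_ℓ E → T_ℓ E'` lies in the `ℤ_ℓ`-span of the maps `T_ℓ φ`, `φ : E → E'` an isogeny over `K`
(the surjectivity half of `Hom_K(E, E') ⊗ ℤ_ℓ ≅ Hom_{Γ_K}(T_ℓ E, T_ℓ E')`).

## Source

G. Faltings, *Endlichkeitssätze für abelsche Varietäten über Zahlkörpern*, Invent. Math. **73**
(1983), 349–366, §5; read in the English translation *Finiteness theorems for abelian varieties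
over number fields*, Ch. II of Cornell–Silverman (eds.), *Arithmetic Geometry*, Springer 1986,
§5 "Endomorphisms". For an abelian variety `A` over a number field `K`, `ℓ` prime,
`π = Gal(K̄/K)`:

* **Satz 4** (Theorem 4): `End_K(A) ⊗_ℤ ℤ_ℓ → End_π(T_ℓ(A))` is an isomorphism;
* **Korollar 1** (Corollary 1): `Hom_K(A₁, A₂) ⊗ ℤ_ℓ → Hom_π(T_ℓ(A₁), T_ℓ(A₂))` is an
  isomorphism — "*Proof.* Theorem 4 applied to `A₁ × A₂`";
* **Korollar 2** (Corollary 2): `A₁ ~ A₂` iff `T_ℓ(A₁) ⊗ ℚ_ℓ ≅ T_ℓ(A₂) ⊗ ℚ_ℓ` as `π`-modules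
  (iff equal local `L`-factors at almost all, iff at all, places) — "(i) ⇔ (ii) follows from
  Theorem 4".

The printed proof of Satz 4 (pp. 89–90 of the translation) first reduces to the statement over
`ℚ_ℓ` ("it suffices"), then, after a finite extension of `K` and an isogeny making `A` semistable
and principally polarised, attaches to a `π`-stable maximal isotropic `W ⊆ V_ℓ(A)` the quotients
`A_n = A / G_n`, shows `h(A_n) = h(A)` (Theorem 2: invariance of the modular height in such
isogeny towers, via Tate–Raynaud on `p`-divisible groups), concludes from Theorem 1 (finiteness
of principally polarised abelian varieties of bounded height) that infinitely many `A_n` are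
isomorphic, and finishes with the Tate–Zarhin argument (`W = u V_ℓ(A)` for some
`u ∈ End_K(A) ⊗ ℚ_ℓ`; general `W` via `A⁸`). None of this — heights, Néron models, `p`-divisible
groups, or even the abelian surface `E × E'` of Korollar 1 — is expressible with the elliptic-curve
preludes, so Satz 4 is **not** proved here and the discharge
`mem_span_range_tateModule_map_of_equivariant_holds` is not asserted.

For elliptic curves the statement file vendors three number-field facts: Satz 4 as
`mem_span_range_tateEndRingHom_iff W ℓ` (an endomorphism of `T_ℓ E` is in the `ℤ_ℓ`-span of the
image of `End_K(E)` iff it is `Γ_K`-equivariant), Korollar 1 as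
`mem_span_range_tateModule_map_of_equivariant W W' ℓ` (its injectivity half being
`linearIndependent_tateModule_map_of_numberField`, *AEC* III.7.4), and Korollar 2 as
`isIsogenous_iff_exists_tateModule_hom_ne_zero W W' ℓ`. The sibling file
`FaltingsECEndomorphismsProofs` reduces Satz 4 for `E` to one deep input — Kor. 1 for `(E, E)`
(`mem_span_range_tateEndRingHom_iff_of_hom`), the `ℚ_ℓ`-statement, or the subspace statement
`stable_subspace_prod_eq_range W ℓ` of `FaltingsECSubspaces` for `E × E`
(`mem_span_range_tateEndRingHom_iff_of_subspaces`). What this file proves is the passage from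
`E' = E` to two curves, i.e. the web of implications ending in Kor. 1 for `(E, E')` that stays
inside the world of elliptic curves.

## Contents (all proved)

* `Literature.AlgebraicGeometry.Motives.mem_span_range_tateModule_map_of_equivariant_self_of`: **Satz 4 for `E` ⟹ Kor. 1
  for `(E, E)`** — the image of `End_K(E)` in `End(T_ℓ E)` lies in the span of the `T_ℓ φ`
  (`range_tateEndRingHom_subset_span`), because an element of `End_K(E)` is `0` or an isogeny
  `E → E` over `K` (the tree's `WeierstrassCurve.mem_geomEndRing_iff_holds`, Silverman *AEC*
  III.§4). (The converse is `mem_span_range_tateEndRingHom_iff_of_hom` in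
  `FaltingsECEndomorphismsProofs`.)
* `Literature.AlgebraicGeometry.Motives.mem_span_range_tateModule_map_of_natCast_smul_mem`: if `d • f ∈ ℤ_ℓ · {T_ℓ φ}` for
  an integer `d ≥ 1` then `f ∈ ℤ_ℓ · {T_ℓ φ}` (`ℓ ≠ char K`), from the `ℓ`-saturation of
  `ℤ_ℓ · {T_ℓ φ} ⊆ Hom_{ℤ_ℓ}(T_ℓ E, T_ℓ E')` proved in the tree
  (`mem_span_tateModule_map_of_pow_smul_mem`, `FaltingsECTateLemma1Proofs`: Tate 1966, §1,
  Lemma 1, from *AEC* Cor. III.4.11) — the two-curve form of the opening sentence of the printed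
  proof of Satz 4 ("it suffices to prove the statement over `ℚ_ℓ`").
* `Literature.AlgebraicGeometry.Motives.mem_span_range_tateModule_map_of_equivariant_of`: **Kor. 1 for `(E, E')` from
  Kor. 1 for `(E', E')` and Kor. 2 for `(E, E')`**, with the dual isogeny (`Isogeny.exists_dual`,
  *AEC* III.6.1), composition of isogenies (the tree's `Isogeny.nonempty_comp_holds`, *AEC*
  III.§4) and III.4.11: for an equivariant `f ≠ 0`, Kor. 2 gives an isogeny `φ₀ : E → E'`; if
  `ψ₀ ∘ φ₀ = [d]` then the equivariant endomorphism `f ∘ T_ℓ ψ₀` of `T_ℓ E'` lies in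
  `ℤ_ℓ · {T_ℓ χ}`, so `d • f = (f ∘ T_ℓ ψ₀) ∘ T_ℓ φ₀ ∈ ℤ_ℓ · {T_ℓ (χ ∘ φ₀)}`, and saturation
  removes `d`. This elliptic-curve shortcut replaces "Theorem 4 applied to `A₁ × A₂`"; it is an
  assembly of cited facts, not the printed proof. The variant `…_of_facts` takes Satz 4 for `E'`
  in its `End_K(E')` form, and `…_of_subspaces` chains it with
  `mem_span_range_tateEndRingHom_iff_of_subspaces`. The converse direction Kor. 1 ⟹ Kor. 2 is
  `Literature.AlgebraicGeometry.Motives.isIsogenous_iff_exists_tateModule_hom_ne_zero_of_satz4` in the sibling file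
  `FaltingsECIsogenyProofs`.
So the named fact `mem_span_range_tateModule_map_of_equivariant W W' ℓ` is reduced
(`…_of_subspaces`) to the two deep named facts `stable_subspace_prod_eq_range W' ℓ` (the theorem
of Faltings proper, for the abelian surface `E' × E'`: Sätze 1–2 and Tate's lattice argument) and
`isIsogenous_iff_exists_tateModule_hom_ne_zero W W' ℓ` (Korollar 2 for `(E, E')`), plus three
named facts from Silverman's Chapter III not yet discharged in the tree (`geomEndRing_comm`,
III.9.4; `Isogeny.exists_dual`, III.6.1; `Isogeny.exists_eq_comp_nsmul_of_geomTorsion_le_ker`,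
III.4.11).

## References

* [Faltings1983Endlichkeit] G. Faltings, Invent. Math. 73 (1983), 349–366, §5: Satz 4,
  Korollar 1, Korollar 2; English translation [Faltings1986FinitenessTranslation] in
  Cornell–Silverman (eds.), *Arithmetic Geometry*, Springer 1986, Ch. II, §5 "Endomorphisms",
  Theorem 4 and Corollaries 1–2 with the proof of Theorems 3–4 (the copy read for this file).
* [Tate1966Endomorphisms] J. Tate, *Endomorphisms of abelian varieties over finite fields*,
  Invent. Math. 2 (1966), 134–144, §1, Lemma 1 (the saturation step, via the tree).
* [SilvermanAEC2009] J. H. Silverman, *The Arithmetic of Elliptic Curves*, 2nd ed., GTM 106,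
  Cor. III.4.11, Thm. III.6.1, Thm. III.7.4, III.7.5.

## Design

Pure theorems, no new definitions. `noncomputable section`; variable conventions as in
`FaltingsECProofs` (`{K : Type u} [Field K] {W W' : WeierstrassCurve K} (ℓ : ℕ) [Fact ℓ.Prime]`);
all theorems in `namespace Literature.Hodge` next to the facts they serve. Imports:
`FaltingsECTateLemma1Proofs` (saturation; it re-exports `FaltingsECProofs` with the isogeny
degrees), `FaltingsECEndomorphismsProofs` (Route 1 and the `End`-form reductions),
`FaltingsECSubspaces` (the fact `stable_subspace_prod_eq_range`), `IsogenyCompProofs` and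
`IsogenyGeomEndRingProofs` (the discharged *AEC* III.§4 facts).
-/

noncomputable section

universe u

namespace Literature.AlgebraicGeometry.Motives

open WeierstrassCurve

variable {K : Type u} [Field K] {W W' : WeierstrassCurve K} (ℓ : ℕ) [Fact ℓ.Prime]

/-! ### Kor. 1 for `(E, E)` versus Satz 4 -/

variable (W) in
/-- For an elliptic curve `E / K`, every element of `End_K(E) = W.endRing` is `0` or the map
underlying an isogeny `E → E` over `K` (the tree's theorem `W.mem_geomEndRing_iff_holds`: an
element of the subring `End_{K̄}(E) = W.geomEndRing` generated by the algebraic endomorphisms is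
`0` or algebraic; finite kernel by `IsAlgebraicOn.finite_ker`), so the image of `End_K(E)` in
`End_{ℤ_ℓ}(T_ℓ E)` lies in the `ℤ_ℓ`-span of the `T_ℓ φ`, `φ : E → E` an isogeny over `K`.
Silverman, *AEC*, III.§4 (`End(E) = Hom(E, E)`). [folklore] -/
theorem range_tateEndRingHom_subset_span [W.IsElliptic] :
    Set.range (tateEndRingHom W ℓ) ⊆
      Submodule.span ℤ_[ℓ] (Set.range fun φ : Isogeny W W ↦ Literature.NumberTheory.EllipticCurves.TateModule.map ℓ φ.toAddMonoidHom) := by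
  rintro _ ⟨e, rfl⟩
  rcases (mem_geomEndRing_iff_holds W e.1).mp e.2.1 with h0 | halg
  · have he : e = 0 := Subtype.ext h0
    rw [he, map_zero]
    exact Submodule.zero_mem _
  · exact Submodule.subset_span
      ⟨⟨e.1, halg, e.2.2, IsAlgebraicOn.finite_ker halg⟩, rfl⟩

variable (W) in
/-- **Satz 4 for `E` implies Kor. 1 for `(E, E)`**: if membership in the `ℤ_ℓ`-span of the image
of `End_K(E)` is equivalent to `Γ_K`-equivariance (`mem_span_range_tateEndRingHom_iff W ℓ`), then
every equivariant endomorphism of `T_ℓ E` lies in the `ℤ_ℓ`-span of the `T_ℓ φ`, `φ : E → E` an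
isogeny over `K` (`mem_span_range_tateModule_map_of_equivariant W W ℓ`), by
`range_tateEndRingHom_subset_span`. The converse implication is
`mem_span_range_tateEndRingHom_iff_of_hom` (`FaltingsECEndomorphismsProofs`). Faltings 1983, §5,
Satz 4 and Korollar 1. [cite: Faltings1983Endlichkeit, Satz 4 with Korollar 1] -/
theorem mem_span_range_tateModule_map_of_equivariant_self_of
    (h : mem_span_range_tateEndRingHom_iff W ℓ) :
    mem_span_range_tateModule_map_of_equivariant W W ℓ := by
  intro _ _ _ f hf
  exact Submodule.span_le.mpr (range_tateEndRingHom_subset_span W ℓ) ((h f).mpr hf)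

/-! ### Removing an integer factor from `d • f ∈ ℤ_ℓ · {T_ℓ φ}` -/

/-- For elliptic curves `E, E'` over a field `K` and a prime `ℓ ≠ char K`: if `d • f` lies in
the `ℤ_ℓ`-span of the `T_ℓ φ` (`φ : E → E'` an isogeny over `K`) for an integer `d ≥ 1`, then so
does `f` — write `d = u ℓ^k` with `u ∈ ℤ_ℓ^×` and use the `ℓ`-saturation of `ℤ_ℓ · {T_ℓ φ}` in
`Hom_{ℤ_ℓ}(T_ℓ E, T_ℓ E')` (the tree's `mem_span_tateModule_map_of_pow_smul_mem`,
`FaltingsECTateLemma1Proofs`: Tate 1966, §1, Lemma 1, from *AEC* Cor. III.4.11, the named fact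
`Isogeny.exists_eq_comp_nsmul_of_geomTorsion_le_ker W W'`). This is the two-curve form of the
opening reduction of Faltings' proof of Satz 4 ("it suffices to prove the statement over `ℚ_ℓ`").
[folklore] -/
theorem mem_span_range_tateModule_map_of_natCast_smul_mem [W.IsElliptic] [W'.IsElliptic]
    (h411 : Isogeny.exists_eq_comp_nsmul_of_geomTorsion_le_ker W W') (hℓ : (ℓ : K) ≠ 0) {d : ℕ}
    (hd : 0 < d) (f : W.tateModule ℓ →ₗ[ℤ_[ℓ]] W'.tateModule ℓ)
    (hf : (d : ℤ_[ℓ]) • f ∈ Submodule.span ℤ_[ℓ]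
      (Set.range fun φ : Isogeny W W' ↦ Literature.NumberTheory.EllipticCurves.TateModule.map ℓ φ.toAddMonoidHom)) :
    f ∈ Submodule.span ℤ_[ℓ]
      (Set.range fun φ : Isogeny W W' ↦ Literature.NumberTheory.EllipticCurves.TateModule.map ℓ φ.toAddMonoidHom) := by
  have hd0 : (d : ℤ_[ℓ]) ≠ 0 := Nat.cast_ne_zero.mpr hd.ne'
  obtain ⟨u, v, hspec⟩ : ∃ (u : ℤ_[ℓ]ˣ) (v : ℕ), (d : ℤ_[ℓ]) = u * (ℓ : ℤ_[ℓ]) ^ v :=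
    ⟨_, _, PadicInt.unitCoeff_spec hd0⟩
  refine mem_span_tateModule_map_of_pow_smul_mem ℓ hℓ h411 (n := v) ?_
  have key : (ℓ : ℤ_[ℓ]) ^ v • f = ((u⁻¹ : ℤ_[ℓ]ˣ) : ℤ_[ℓ]) • ((d : ℤ_[ℓ]) • f) := by
    rw [hspec, smul_smul, ← mul_assoc, Units.inv_mul, one_mul]
  rw [key]
  exact Submodule.smul_mem _ _ hf

/-! ### Kor. 1 for `(E, E')` from Satz 4 for `E'` and Kor. 2 -/

variable (W W') in
/-- **Kor. 1 for `(E, E')` from Kor. 1 for `(E', E')` (= Satz 4 for `E'`) and Kor. 2 for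
`(E, E')`.** Let `E, E'` be elliptic curves over a number field `K` and `ℓ` a prime. Assume:
Kor. 1 for the pair `(E', E')` (`hEnd`, i.e. Satz 4 for `E'` in span form, cf.
`mem_span_range_tateModule_map_of_equivariant_self_of`); Kor. 2 for `(E, E')` (`hisog`); the dual
isogeny (`hdual`: `ψ ∘ φ = [deg φ]`, *AEC* III.6.1); and *AEC* III.4.11 for `[m]` (`h411`);
composites of isogenies are isogenies by the tree's `Isogeny.nonempty_comp_holds` (*AEC* III.§4).
Then every `Γ_K`-equivariant
`ℤ_ℓ`-linear `f : T_ℓ E → T_ℓ E'` lies in the `ℤ_ℓ`-span of the `T_ℓ φ`, `φ : E → E'` an isogeny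
over `K`. Proof: for `f ≠ 0`, Kor. 2 yields an isogeny `φ₀ : E → E'`; with `ψ₀ ∘ φ₀ = [d]`, the
equivariant endomorphism `f ∘ T_ℓ ψ₀` of `T_ℓ E'` is in `ℤ_ℓ · {T_ℓ χ}`, hence
`d • f = (f ∘ T_ℓ ψ₀) ∘ T_ℓ φ₀ ∈ ℤ_ℓ · {T_ℓ (χ ∘ φ₀)}`, and `ℓ`-saturation
(`mem_span_range_tateModule_map_of_natCast_smul_mem`, from Tate's Lemma 1 in
`FaltingsECTateLemma1Proofs`) removes `d`. An elliptic-curve substitute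
for Faltings' "Theorem 4 applied to `A₁ × A₂`". Faltings 1983, §5, Satz 4, Korollar 1,
Korollar 2. [cite: Faltings1983Endlichkeit, Satz 4, Korollar 1 and Korollar 2] -/
theorem mem_span_range_tateModule_map_of_equivariant_of
    (hEnd : mem_span_range_tateModule_map_of_equivariant W' W' ℓ)
    (hisog : isIsogenous_iff_exists_tateModule_hom_ne_zero W W' ℓ)
    (hdual : Isogeny.exists_dual (W := W) (W' := W'))
    (h411 : Isogeny.exists_eq_comp_nsmul_of_geomTorsion_le_ker W W') :
    mem_span_range_tateModule_map_of_equivariant W W' ℓ := by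
  intro _ _ _ f hf
  set Mℓ := Submodule.span ℤ_[ℓ]
    (Set.range fun φ : Isogeny W W' ↦ Literature.NumberTheory.EllipticCurves.TateModule.map ℓ φ.toAddMonoidHom) with hMℓ
  have hℓ : (ℓ : K) ≠ 0 := Nat.cast_ne_zero.mpr (Fact.out : ℓ.Prime).ne_zero
  by_cases hf0 : f = 0
  · rw [hf0]
    exact Mℓ.zero_mem
  -- Kor. 2: an isogeny `φ₀ : E → E'`, and its dual `ψ₀` with `ψ₀ ∘ φ₀ = [d]`
  have hisog' : W.IsIsogenous W' ↔ ∃ g : W.tateModule ℓ →ₗ[ℤ_[ℓ]] W'.tateModule ℓ,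
      g ≠ 0 ∧ ∀ (σ : Field.absoluteGaloisGroup K) (x : W.tateModule ℓ), g (σ • x) = σ • g x :=
    hisog
  obtain ⟨φ₀⟩ := hisog'.mpr ⟨f, hf0, hf⟩
  obtain ⟨ψ₀, hψ₀⟩ := hdual φ₀
  set d : ℕ := φ₀.degree with hd
  have hdpos : 0 < d := φ₀.degree_pos
  -- `g = f ∘ T ψ₀` is an equivariant endomorphism of `T E'`
  set g : W'.tateModule ℓ →ₗ[ℤ_[ℓ]] W'.tateModule ℓ :=
    f ∘ₗ Literature.NumberTheory.EllipticCurves.TateModule.map ℓ ψ₀.toAddMonoidHom with hg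
  have hgeq : ∀ (σ : Field.absoluteGaloisGroup K) (y : W'.tateModule ℓ), g (σ • y) = σ • g y := by
    intro σ y
    rw [hg, LinearMap.comp_apply, LinearMap.comp_apply, tateModule_map_smul ℓ ψ₀ σ y, hf]
  have hgmem := hEnd g hgeq
  -- `T ψ₀ ∘ T φ₀ = d`
  have hcomp₀ : Literature.NumberTheory.EllipticCurves.TateModule.map ℓ ψ₀.toAddMonoidHom ∘ₗ Literature.NumberTheory.EllipticCurves.TateModule.map ℓ φ₀.toAddMonoidHom =
      (d : ℤ_[ℓ]) • LinearMap.id := by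
    refine LinearMap.ext fun x ↦ Literature.NumberTheory.EllipticCurves.TateModule.ext fun n ↦ ?_
    rw [LinearMap.comp_apply, Literature.NumberTheory.EllipticCurves.TateModule.proj_map, Literature.NumberTheory.EllipticCurves.TateModule.proj_map, LinearMap.smul_apply,
      LinearMap.id_apply, Literature.NumberTheory.EllipticCurves.TateModule.proj_natCast_smul, Isogeny.coe_toAddMonoidHom,
      Isogeny.coe_toAddMonoidHom, hψ₀, natCast_zsmul]
  have hdf : (d : ℤ_[ℓ]) • f = g ∘ₗ Literature.NumberTheory.EllipticCurves.TateModule.map ℓ φ₀.toAddMonoidHom := by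
    rw [hg, LinearMap.comp_assoc, hcomp₀, LinearMap.comp_smul, LinearMap.comp_id]
  -- composing `ℤ_ℓ · {T χ}` with `T φ₀` lands in `Mℓ`
  have hspan : ∀ g' ∈ Submodule.span ℤ_[ℓ]
      (Set.range fun χ : Isogeny W' W' ↦ Literature.NumberTheory.EllipticCurves.TateModule.map ℓ χ.toAddMonoidHom),
      g' ∘ₗ Literature.NumberTheory.EllipticCurves.TateModule.map ℓ φ₀.toAddMonoidHom ∈ Mℓ := by
    intro g' hg'
    induction hg' using Submodule.span_induction with
    | mem g' hg' =>
      obtain ⟨χ, rfl⟩ := hg'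
      obtain ⟨ρ, hρ⟩ := Isogeny.nonempty_comp_holds W W' χ φ₀
      have hTρ : Literature.NumberTheory.EllipticCurves.TateModule.map ℓ χ.toAddMonoidHom ∘ₗ Literature.NumberTheory.EllipticCurves.TateModule.map ℓ φ₀.toAddMonoidHom =
          Literature.NumberTheory.EllipticCurves.TateModule.map ℓ ρ.toAddMonoidHom := by
        refine LinearMap.ext fun x ↦ Literature.NumberTheory.EllipticCurves.TateModule.ext fun n ↦ ?_
        rw [LinearMap.comp_apply, Literature.NumberTheory.EllipticCurves.TateModule.proj_map, Literature.NumberTheory.EllipticCurves.TateModule.proj_map, Literature.NumberTheory.EllipticCurves.TateModule.proj_map,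
          Isogeny.coe_toAddMonoidHom, Isogeny.coe_toAddMonoidHom, Isogeny.coe_toAddMonoidHom, hρ]
      rw [hTρ]
      exact Submodule.subset_span ⟨ρ, rfl⟩
    | zero => rw [LinearMap.zero_comp]; exact Mℓ.zero_mem
    | add g₁ g₂ _ _ h₁ h₂ => rw [LinearMap.add_comp]; exact Mℓ.add_mem h₁ h₂
    | smul r g₁ _ h₁ => rw [LinearMap.smul_comp]; exact Mℓ.smul_mem r h₁
  have hdfmem : (d : ℤ_[ℓ]) • f ∈ Mℓ := by
    rw [hdf]
    exact hspan g hgmem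
  exact mem_span_range_tateModule_map_of_natCast_smul_mem ℓ h411 hℓ hdpos f hdfmem

variable (W W') in
/-- **Kor. 1 for `(E, E')` from Satz 4 for `E'` and Kor. 2**, the variant of
`mem_span_range_tateModule_map_of_equivariant_of` with Satz 4 in its `End_K(E')` form (the named
fact `mem_span_range_tateEndRingHom_iff W' ℓ`). Faltings 1983, §5, Satz 4, Korollar 1,
Korollar 2. [cite: Faltings1983Endlichkeit, Satz 4, Korollar 1 and Korollar 2] -/
theorem mem_span_range_tateModule_map_of_equivariant_of_facts
    (hEnd : mem_span_range_tateEndRingHom_iff W' ℓ)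
    (hisog : isIsogenous_iff_exists_tateModule_hom_ne_zero W W' ℓ)
    (hdual : Isogeny.exists_dual (W := W) (W' := W'))
    (h411 : Isogeny.exists_eq_comp_nsmul_of_geomTorsion_le_ker W W') :
    mem_span_range_tateModule_map_of_equivariant W W' ℓ :=
  mem_span_range_tateModule_map_of_equivariant_of W W' ℓ
    (mem_span_range_tateModule_map_of_equivariant_self_of W' ℓ hEnd) hisog hdual h411

variable (W W') in
/-- **Kor. 1 for `(E, E')` from subspace realization for `E' × E'` and Kor. 2** — the assembled
reduction of the named fact `mem_span_range_tateModule_map_of_equivariant W W' ℓ` to the deep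
inputs the tree isolates: (`hX`) the named fact `stable_subspace_prod_eq_range W' ℓ`
(`FaltingsECSubspaces`: every `Γ_K`-stable `ℚ_ℓ`-subspace of `V_ℓ E' × V_ℓ E'` is the image of a
`2 × 2` matrix over `E'_ℓ = image(End_K(E') ⊗ ℚ_ℓ)` — Faltings' "`W` is the image of an
idempotent `u ∈ End_K(A) ⊗ ℚ_ℓ`" for `A = E' × E'`, i.e. Sätze 1–2 and Tate's lattice argument),
from which `mem_span_range_tateEndRingHom_iff_of_subspaces` (`FaltingsECEndomorphismsProofs`)
derives Satz 4 for `E'` granted (`hcomm`) the named fact `W'.geomEndRing_comm` (*AEC* III.9.4)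
and (`h411'`) *AEC* III.4.11 for `E'`; and (`hisog`) Korollar 2 for `(E, E')`, with the dual
isogeny (`hdual`, *AEC* III.6.1) and *AEC* III.4.11 for `(E, E')` (`h411`). Faltings 1983, §5,
Satz 4 (with its proof), Korollar 1, Korollar 2.
[cite: Faltings1983Endlichkeit, Satz 4, Korollar 1 and Korollar 2] -/
theorem mem_span_range_tateModule_map_of_equivariant_of_subspaces
    (hX : stable_subspace_prod_eq_range W' ℓ) (hcomm : W'.geomEndRing_comm)
    (h411' : Isogeny.exists_eq_comp_nsmul_of_geomTorsion_le_ker W' W')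
    (hisog : isIsogenous_iff_exists_tateModule_hom_ne_zero W W' ℓ)
    (hdual : Isogeny.exists_dual (W := W) (W' := W'))
    (h411 : Isogeny.exists_eq_comp_nsmul_of_geomTorsion_le_ker W W') :
    mem_span_range_tateModule_map_of_equivariant W W' ℓ :=
  mem_span_range_tateModule_map_of_equivariant_of_facts W W' ℓ
    (mem_span_range_tateEndRingHom_iff_of_subspaces W' ℓ (fun U hU ↦ hX U hU) hcomm
      (mem_geomEndRing_iff_holds W') h411')
    hisog hdual h411

end Literature.AlgebraicGeometry.Motives
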